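/-
Copyright (c) 2026 the pub-hodgecm-mathlib formalisation cell (harness21).  Prover seat hodgecm-mathlib-F0P3a-p07 (g16): line LH3 (closer stub `stub_N9`), organ J,
brick (B-STD) «STANDARDISE THE BLOCK» (LH3-p02 (g3) carrier flag 2026-09-02T08:16:00Z; LH3-plan (g3) RULINGS #9 (i) by name).
-/
import Literature.NumberTheory.Automorphic.ArchRankOneJumpZeroCone          -- ★ p850353 (this seat): `formCongr_cayleyTwo_of_eq_over`, `cayley_conj_circleDiagonal_mem_of_eq_over`; brings ★ `unitaryGroupOfFormCongr`, ★ `coe_inv_cayleyTwo`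
import Literature.NumberTheory.Automorphic.ArchRankOneJumpZeroWeights       -- ★ p850146 (LH10-p02): `circleDiagonal_mem_unitaryGroupOfForm_diagonal_map_weights` (the torus membership token on the diagonal carrier)
import HarnessLib

/-!
# Standardising the rank-one block: a FIXED isomorphism `U(σ(diag a)) ≃ₜ* U(J)`, `J = Φ₂`, carrying the circle torus to the Cayley torus
# (Platonov–Rapinchuk 1994 §2.3; Rogawski 1990 §3.6, §8.2 p. 122)

Topic `NumberTheory/Automorphic`; namespace `Literature.NumberTheory.Automorphic.UnitaryGroup`.  THEOREMS ONLY (no `def`, no instance, no notation, no axiom, no named fact, no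
`sorry`).  Cell `pub/hodgecm-mathlib`, line LH3 (closer stub `stub_N9`, crux H413 = `stmt-HodgeConjecture-24833`), organ J, brick **(B-STD)** (LH3-p02 (g3) carrier flag
2026-09-02T08:16:00Z, LH3-plan (g3) RULINGS #9 (i)): the descended `G′`-block `B = U(σ_w diag(a₀, a₁))` of (M-UNFOLD) wears a DIAGONAL real form of signature `(1,1)` with the
circle torus `diag(u₀, u₁)`, whereas the shared rank-one datum of RULINGS #8 — ★ (K0±-FORM-TRANSPORT) p850353, ★ (A0-b∕c) p850189∕p850345, (J-CONST) ★ p850433 — lives on `U(J)`,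
`hJ : J = (StdForm.antidiagonal 2).over ℂ`, with the CAYLEY torus `P·diag(u)·P⁻¹`.  This file supplies ONE fixed topological-group isomorphism `φ : B ≃ₜ* U(J)`,
`φ h = (P·D)·h·(P·D)⁻¹` with `P = (1 1; 1 −1)` and `D = diag(√(|e₀|∕2), √(|e₁|∕2))`, `e_i = re σ(a_i)` (so that `D̄ᵀ (P̄ᵀ J P) D = D·diag(2,−2)·D = diag(|e₀|, −|e₁|) = ±diag(e₀, e₁)`,
the sign being absorbed by `U(−H) = U(H)`), which maps the circle torus element `diag(u)` to the Cayley torus element `P·diag(u)·P⁻¹` ON THE NOSE (`D` is diagonal and commutes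
with `diag(u)`).  Every consumer composes `eM := e.trans (φ.prodCongr (ContinuousMulEquiv.refl _))` and reads ★ p850353's `hjump` by `exact` with the shared Haar measure.

* `det_blockScale_ne_zero` — `det D ≠ 0`.
* `formCongr_cayley_blockScale` — `formCongr conj (P·D) J = diagonal ![|e₀|, −|e₁|]`.
* `unitaryGroupOfForm_diagonal_map_eq_formCongr` — `U(σ(diag a)) = U(formCongr conj (P·D) J)` as subgroups of `GL₂(ℂ)` (both sign cases).
* **`exists_continuousMulEquiv_diagonal_weights_std`** — THE HEAD (LH3-p02's text): `∃ φ`, torus clause + value clause; `…_symm` value clause for `φ⁻¹`.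
HONEST LABEL: HC_CM is proved only modulo the 7 printed citations (2 remaining: hLiu418 = stmt-HodgeConjecture-24832, h413 = stmt-HodgeConjecture-24833) until rung 0 closes; frame
bookkeeping, count-neutral, pays nothing by itself.

## References
* [PlatonovRapinchuk1994] V. Platonov, A. Rapinchuk, *Algebraic Groups and Number Theory* (1994), §2.3 (unitary groups of congruent hermitian forms).
* [Rogawski1990] J. D. Rogawski, *Automorphic Representations of Unitary Groups in Three Variables*, Ann. of Math. Stud. 123 (1990), §3.6 p. 31; §8.2 p. 122 (the Cayley frame).
-/

set_option autoImplicit false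

noncomputable section

namespace Literature.NumberTheory.Automorphic.UnitaryGroup

open _root_.Complex
open scoped Real MatrixGroups

variable {L : Type*} [CommRing L] (σ : L →+* ℂ) (a : Fin 2 → L)
variable {J : Matrix (Fin 2) (Fin 2) ℂ} (hJ : J = (StdForm.antidiagonal 2).over ℂ)

/-! ## §1 The scaling matrix `D = diag(√(|e₀|∕2), √(|e₁|∕2))` -/

/-- `det D = √(|e₀|∕2)·√(|e₁|∕2) ≠ 0` when `e₀ e₁ < 0`. [cite: PlatonovRapinchuk1994, §2.3] -/
theorem det_blockScale_ne_zero (e₀ e₁ : ℝ) (h : e₀ * e₁ < 0) :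
    (Matrix.diagonal ![((Real.sqrt (|e₀| / 2) : ℝ) : ℂ), ((Real.sqrt (|e₁| / 2) : ℝ) : ℂ)]).det ≠ 0 := by
  have h0 : e₀ ≠ 0 := fun h0 => by rw [h0, zero_mul] at h; exact lt_irrefl _ h
  have h1 : e₁ ≠ 0 := fun h1 => by rw [h1, mul_zero] at h; exact lt_irrefl _ h
  have hs0 : 0 < Real.sqrt (|e₀| / 2) := Real.sqrt_pos.2 (by positivity)
  have hs1 : 0 < Real.sqrt (|e₁| / 2) := Real.sqrt_pos.2 (by positivity)
  rw [Matrix.det_diagonal, Fin.prod_univ_two]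
  simp only [Matrix.cons_val_zero, Matrix.cons_val_one]
  exact mul_ne_zero (Complex.ofReal_ne_zero.2 hs0.ne') (Complex.ofReal_ne_zero.2 hs1.ne')

/-- The real-diagonal reading of the form: `σ(diag a) = diag(e₀, e₁)` with `e_i = re σ(a_i)` when `σ(a_i)` is real. [cite: Rogawski1990, §3.6 p. 31] -/
theorem diagonal_map_eq_of_im_eq_zero (hreal : ∀ i, (σ (a i)).im = 0) :
    (Matrix.diagonal a).map σ = Matrix.diagonal ![(((σ (a 0)).re : ℝ) : ℂ), (((σ (a 1)).re : ℝ) : ℂ)] := by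
  rw [Matrix.diagonal_map (map_zero σ)]
  congr 1
  funext i
  fin_cases i
  · exact Complex.ext (by simp) (by simp [hreal 0])
  · exact Complex.ext (by simp) (by simp [hreal 1])

include hJ in
/-- **`formCongr conj (P·D) J = diag(|e₀|, −|e₁|)`**: `D̄ᵀ (P̄ᵀ J P) D = D·diag(2,−2)·D` and `2·(√(|e|∕2))² = |e|`. [cite: PlatonovRapinchuk1994, §2.3] [cite: Rogawski1990, §8.2 p. 122] -/
theorem formCongr_cayley_blockScale (e₀ e₁ : ℝ) (h : e₀ * e₁ < 0) :
    formCongr (starRingEnd ℂ)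
        (Matrix.GeneralLinearGroup.mkOfDetNeZero !![(1 : ℂ), 1; 1, -1] det_cayleyTwo_ne_zero *
          Matrix.GeneralLinearGroup.mkOfDetNeZero (Matrix.diagonal ![((Real.sqrt (|e₀| / 2) : ℝ) : ℂ), ((Real.sqrt (|e₁| / 2) : ℝ) : ℂ)])
            (det_blockScale_ne_zero e₀ e₁ h)) J =
      Matrix.diagonal ![((|e₀| : ℝ) : ℂ), -((|e₁| : ℝ) : ℂ)] := by
  have hP := formCongr_cayleyTwo_of_eq_over hJ
  have h2 : ∀ e : ℝ, ((Real.sqrt (|e| / 2) : ℝ) : ℂ) * 2 * ((Real.sqrt (|e| / 2) : ℝ) : ℂ) = ((|e| : ℝ) : ℂ) := fun e => by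
    have hs : Real.sqrt (|e| / 2) * Real.sqrt (|e| / 2) = |e| / 2 := Real.mul_self_sqrt (by positivity)
    have : ((Real.sqrt (|e| / 2) : ℝ) : ℂ) * ((Real.sqrt (|e| / 2) : ℝ) : ℂ) = (((|e| / 2 : ℝ)) : ℂ) := by exact_mod_cast hs
    calc ((Real.sqrt (|e| / 2) : ℝ) : ℂ) * 2 * ((Real.sqrt (|e| / 2) : ℝ) : ℂ)
        = 2 * (((Real.sqrt (|e| / 2) : ℝ) : ℂ) * ((Real.sqrt (|e| / 2) : ℝ) : ℂ)) := by ring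
      _ = ((|e| : ℝ) : ℂ) := by rw [this]; push_cast; ring
  simp only [formCongr] at hP ⊢
  rw [Units.val_mul, Matrix.map_mul, Matrix.transpose_mul,
    show ∀ X Y Z W : Matrix (Fin 2) (Fin 2) ℂ, X * Y * J * (Z * W) = X * (Y * J * Z) * W by intros; simp only [Matrix.mul_assoc], hP,
    Matrix.GeneralLinearGroup.val_mkOfDetNeZero]
  have hc : ∀ e : ℝ, (starRingEnd ℂ) (((Real.sqrt (|e| / 2) : ℝ) : ℂ)) = ((Real.sqrt (|e| / 2) : ℝ) : ℂ) := fun e => Complex.conj_ofReal _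
  rw [Matrix.diagonal_map (Complex.conj_ofReal 0 ▸ (map_zero (starRingEnd ℂ))), Matrix.diagonal_transpose, Matrix.diagonal_mul_diagonal,
    Matrix.diagonal_mul_diagonal]
  congr 1
  funext i
  fin_cases i
  · simp only [Fin.zero_eta, Fin.isValue, Matrix.cons_val_zero, hc]
    linear_combination h2 e₀
  · simp only [Fin.mk_one, Fin.isValue, Matrix.cons_val_one, Matrix.cons_val_zero, hc]
    linear_combination (-1 : ℂ) * h2 e₁

/-! ## §2 The block carrier equals the congruent standard carrier, and the standardising isomorphism -/

/-- **`U(σ(diag a)) = U(formCongr conj (P·D) J)` as subgroups of `GL₂(ℂ)`** (real weights of opposite signs): `formCongr (P·D) J = diag(|e₀|, −|e₁|)` is `diag(e₀, e₁)` if `e₀ > 0`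
and `−diag(e₀, e₁)` if `e₀ < 0`, and `U(−H) = U(H)`. [cite: PlatonovRapinchuk1994, §2.3] -/
theorem unitaryGroupOfForm_diagonal_map_eq_formCongr (σ : L →+* ℂ) (a : Fin 2 → L) (hreal : ∀ i, (σ (a i)).im = 0)
    (hsgn : (σ (a 0)).re * (σ (a 1)).re < 0) (hJ : J = (StdForm.antidiagonal 2).over ℂ) :
    unitaryGroupOfForm (starRingEnd ℂ) ((Matrix.diagonal a).map σ) =
      unitaryGroupOfForm (starRingEnd ℂ) (formCongr (starRingEnd ℂ)
        (Matrix.GeneralLinearGroup.mkOfDetNeZero !![(1 : ℂ), 1; 1, -1] det_cayleyTwo_ne_zero *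
          Matrix.GeneralLinearGroup.mkOfDetNeZero
            (Matrix.diagonal ![((Real.sqrt (|(σ (a 0)).re| / 2) : ℝ) : ℂ), ((Real.sqrt (|(σ (a 1)).re| / 2) : ℝ) : ℂ)])
            (det_blockScale_ne_zero _ _ hsgn)) J) := by
  rw [formCongr_cayley_blockScale hJ _ _ hsgn, diagonal_map_eq_of_im_eq_zero σ a hreal]
  have h0 : (σ (a 0)).re ≠ 0 := fun h0 => by rw [h0, zero_mul] at hsgn; exact lt_irrefl _ hsgn
  rcases lt_or_gt_of_ne h0 with hneg | hpos
  · -- `e₀ < 0 < e₁`: the congruent form is `−diag(e₀, e₁)`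
    have he₁ : 0 < (σ (a 1)).re := by nlinarith
    have hmat : Matrix.diagonal ![((|(σ (a 0)).re| : ℝ) : ℂ), -((|(σ (a 1)).re| : ℝ) : ℂ)] =
        -Matrix.diagonal ![(((σ (a 0)).re : ℝ) : ℂ), (((σ (a 1)).re : ℝ) : ℂ)] := by
      rw [abs_of_neg hneg, abs_of_pos he₁]
      ext i j
      fin_cases i <;> fin_cases j <;> simp
    rw [hmat]
    ext g
    rw [mem_unitaryGroupOfForm_iff, mem_unitaryGroupOfForm_iff, Matrix.mul_neg, Matrix.neg_mul, neg_inj]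
  · -- `e₀ > 0 > e₁`: the congruent form is `diag(e₀, e₁)` itself
    have he₁ : (σ (a 1)).re < 0 := by nlinarith
    have hmat : Matrix.diagonal ![((|(σ (a 0)).re| : ℝ) : ℂ), -((|(σ (a 1)).re| : ℝ) : ℂ)] =
        Matrix.diagonal ![(((σ (a 0)).re : ℝ) : ℂ), (((σ (a 1)).re : ℝ) : ℂ)] := by
      rw [abs_of_pos hpos, abs_of_neg he₁]
      congr 1
      funext i
      fin_cases i <;> simp
    rw [hmat]

/-- **(B-STD) — STANDARDISING THE BLOCK.**  For real diagonal weights of opposite signs there is ONE FIXED topological-group isomorphism `φ : U(σ(diag a)) ≃ₜ* U(J)`, `J = Φ₂`,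
`φ h = (P·D)·h·(P·D)⁻¹` (`P = (1 1; 1 −1)`, `D = diag(√(|e₀|∕2), √(|e₁|∕2))`, `e_i = re σ(a_i)`), which carries the circle torus element `diag(u)` to the Cayley torus element
`P·diag(u)·P⁻¹` on the nose (LH3-p02 (g3)'s text).  Consumers: `eM := e.trans (φ.prodCongr (ContinuousMulEquiv.refl _))` in (M-UNFOLD)∕(J-G′-BLOCK), so that ★ p850353's `hjump`
is `exact` with the shared Haar measure. [cite: PlatonovRapinchuk1994, §2.3] [cite: Rogawski1990, §3.6 p. 31; §8.2 p. 122] -/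
theorem exists_continuousMulEquiv_diagonal_weights_std (σ : L →+* ℂ) (a : Fin 2 → L) (hreal : ∀ i, (σ (a i)).im = 0)
    (hsgn : (σ (a 0)).re * (σ (a 1)).re < 0) (hJ : J = (StdForm.antidiagonal 2).over ℂ) :
    ∃ φ : ↥(unitaryGroupOfForm (starRingEnd ℂ) ((Matrix.diagonal a).map σ)) ≃ₜ* ↥(unitaryGroupOfForm (starRingEnd ℂ) J),
      (∀ u : Fin 2 → Circle,
        φ ⟨circleDiagonal 2 u, circleDiagonal_mem_unitaryGroupOfForm_diagonal_map_weights σ a u⟩ =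
          ⟨Matrix.GeneralLinearGroup.mkOfDetNeZero !![(1 : ℂ), 1; 1, -1] det_cayleyTwo_ne_zero * circleDiagonal 2 u *
              (Matrix.GeneralLinearGroup.mkOfDetNeZero !![(1 : ℂ), 1; 1, -1] det_cayleyTwo_ne_zero)⁻¹,
            cayley_conj_circleDiagonal_mem_of_eq_over hJ u⟩) ∧
      (∀ h : ↥(unitaryGroupOfForm (starRingEnd ℂ) ((Matrix.diagonal a).map σ)),
        ((φ h : ↥(unitaryGroupOfForm (starRingEnd ℂ) J)) : GL (Fin 2) ℂ) =
          Matrix.GeneralLinearGroup.mkOfDetNeZero !![(1 : ℂ), 1; 1, -1] det_cayleyTwo_ne_zero *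
            Matrix.GeneralLinearGroup.mkOfDetNeZero
              (Matrix.diagonal ![((Real.sqrt (|(σ (a 0)).re| / 2) : ℝ) : ℂ), ((Real.sqrt (|(σ (a 1)).re| / 2) : ℝ) : ℂ)])
              (det_blockScale_ne_zero _ _ hsgn) * (h : GL (Fin 2) ℂ) *
          (Matrix.GeneralLinearGroup.mkOfDetNeZero !![(1 : ℂ), 1; 1, -1] det_cayleyTwo_ne_zero *
            Matrix.GeneralLinearGroup.mkOfDetNeZero
              (Matrix.diagonal ![((Real.sqrt (|(σ (a 0)).re| / 2) : ℝ) : ℂ), ((Real.sqrt (|(σ (a 1)).re| / 2) : ℝ) : ℂ)])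
              (det_blockScale_ne_zero _ _ hsgn))⁻¹) := by
  have hU := unitaryGroupOfForm_diagonal_map_eq_formCongr σ a hreal hsgn hJ
  -- the identity map between the two equal subgroups, as a topological-group isomorphism
  let ι : ↥(unitaryGroupOfForm (starRingEnd ℂ) ((Matrix.diagonal a).map σ)) ≃ₜ*
      ↥(unitaryGroupOfForm (starRingEnd ℂ) (formCongr (starRingEnd ℂ)
        (Matrix.GeneralLinearGroup.mkOfDetNeZero !![(1 : ℂ), 1; 1, -1] det_cayleyTwo_ne_zero *
          Matrix.GeneralLinearGroup.mkOfDetNeZero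
            (Matrix.diagonal ![((Real.sqrt (|(σ (a 0)).re| / 2) : ℝ) : ℂ), ((Real.sqrt (|(σ (a 1)).re| / 2) : ℝ) : ℂ)])
            (det_blockScale_ne_zero _ _ hsgn)) J)) :=
    { MulEquiv.subgroupCongr hU with
      continuous_toFun := continuous_induced_rng.2 continuous_subtype_val
      continuous_invFun := continuous_induced_rng.2 continuous_subtype_val }
  refine ⟨ι.trans (unitaryGroupOfFormCongr (starRingEnd ℂ) _ J), fun u => ?_, fun h => rfl⟩
  -- the torus clause: `D` is diagonal, so it commutes with `diag(u)`
  apply Subtype.ext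
  show Matrix.GeneralLinearGroup.mkOfDetNeZero !![(1 : ℂ), 1; 1, -1] det_cayleyTwo_ne_zero *
        Matrix.GeneralLinearGroup.mkOfDetNeZero
          (Matrix.diagonal ![((Real.sqrt (|(σ (a 0)).re| / 2) : ℝ) : ℂ), ((Real.sqrt (|(σ (a 1)).re| / 2) : ℝ) : ℂ)])
          (det_blockScale_ne_zero _ _ hsgn) * circleDiagonal 2 u *
      (Matrix.GeneralLinearGroup.mkOfDetNeZero !![(1 : ℂ), 1; 1, -1] det_cayleyTwo_ne_zero *
        Matrix.GeneralLinearGroup.mkOfDetNeZero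
          (Matrix.diagonal ![((Real.sqrt (|(σ (a 0)).re| / 2) : ℝ) : ℂ), ((Real.sqrt (|(σ (a 1)).re| / 2) : ℝ) : ℂ)])
          (det_blockScale_ne_zero _ _ hsgn))⁻¹ =
      Matrix.GeneralLinearGroup.mkOfDetNeZero !![(1 : ℂ), 1; 1, -1] det_cayleyTwo_ne_zero * circleDiagonal 2 u *
        (Matrix.GeneralLinearGroup.mkOfDetNeZero !![(1 : ℂ), 1; 1, -1] det_cayleyTwo_ne_zero)⁻¹
  have hDc : Matrix.GeneralLinearGroup.mkOfDetNeZero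
        (Matrix.diagonal ![((Real.sqrt (|(σ (a 0)).re| / 2) : ℝ) : ℂ), ((Real.sqrt (|(σ (a 1)).re| / 2) : ℝ) : ℂ)])
        (det_blockScale_ne_zero _ _ hsgn) * circleDiagonal 2 u =
      circleDiagonal 2 u * Matrix.GeneralLinearGroup.mkOfDetNeZero
        (Matrix.diagonal ![((Real.sqrt (|(σ (a 0)).re| / 2) : ℝ) : ℂ), ((Real.sqrt (|(σ (a 1)).re| / 2) : ℝ) : ℂ)])
        (det_blockScale_ne_zero _ _ hsgn) := by
    apply Units.ext
    simp only [Units.val_mul, coe_circleDiagonal, Matrix.GeneralLinearGroup.val_mkOfDetNeZero, Matrix.diagonal_mul_diagonal]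
    congr 1
    funext i
    ring
  rw [mul_inv_rev, show ∀ P D c Di Pi : GL (Fin 2) ℂ, P * D * c * (Di * Pi) = P * (D * c * Di) * Pi by intros; simp only [mul_assoc], hDc,
    mul_inv_cancel_right]

/-- **The inverse on underlying elements**: `φ⁻¹ g = (P·D)⁻¹·g·(P·D)` — for reading `U(J)`-side tokens (e.g. the split torus `hypBlockGL x θ`) back on the block.
[cite: PlatonovRapinchuk1994, §2.3] -/
theorem exists_continuousMulEquiv_diagonal_weights_std_symm (σ : L →+* ℂ) (a : Fin 2 → L) (hreal : ∀ i, (σ (a i)).im = 0)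
    (hsgn : (σ (a 0)).re * (σ (a 1)).re < 0) (hJ : J = (StdForm.antidiagonal 2).over ℂ) :
    ∃ φ : ↥(unitaryGroupOfForm (starRingEnd ℂ) ((Matrix.diagonal a).map σ)) ≃ₜ* ↥(unitaryGroupOfForm (starRingEnd ℂ) J),
      (∀ u : Fin 2 → Circle,
        φ ⟨circleDiagonal 2 u, circleDiagonal_mem_unitaryGroupOfForm_diagonal_map_weights σ a u⟩ =
          ⟨Matrix.GeneralLinearGroup.mkOfDetNeZero !![(1 : ℂ), 1; 1, -1] det_cayleyTwo_ne_zero * circleDiagonal 2 u *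
              (Matrix.GeneralLinearGroup.mkOfDetNeZero !![(1 : ℂ), 1; 1, -1] det_cayleyTwo_ne_zero)⁻¹,
            cayley_conj_circleDiagonal_mem_of_eq_over hJ u⟩) ∧
      (∀ h : ↥(unitaryGroupOfForm (starRingEnd ℂ) ((Matrix.diagonal a).map σ)),
        ((φ h : ↥(unitaryGroupOfForm (starRingEnd ℂ) J)) : GL (Fin 2) ℂ) =
          Matrix.GeneralLinearGroup.mkOfDetNeZero !![(1 : ℂ), 1; 1, -1] det_cayleyTwo_ne_zero *
            Matrix.GeneralLinearGroup.mkOfDetNeZero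
              (Matrix.diagonal ![((Real.sqrt (|(σ (a 0)).re| / 2) : ℝ) : ℂ), ((Real.sqrt (|(σ (a 1)).re| / 2) : ℝ) : ℂ)])
              (det_blockScale_ne_zero _ _ hsgn) * (h : GL (Fin 2) ℂ) *
          (Matrix.GeneralLinearGroup.mkOfDetNeZero !![(1 : ℂ), 1; 1, -1] det_cayleyTwo_ne_zero *
            Matrix.GeneralLinearGroup.mkOfDetNeZero
              (Matrix.diagonal ![((Real.sqrt (|(σ (a 0)).re| / 2) : ℝ) : ℂ), ((Real.sqrt (|(σ (a 1)).re| / 2) : ℝ) : ℂ)])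
              (det_blockScale_ne_zero _ _ hsgn))⁻¹) ∧
      (∀ g : ↥(unitaryGroupOfForm (starRingEnd ℂ) J),
        ((φ.symm g : ↥(unitaryGroupOfForm (starRingEnd ℂ) ((Matrix.diagonal a).map σ))) : GL (Fin 2) ℂ) =
          (Matrix.GeneralLinearGroup.mkOfDetNeZero !![(1 : ℂ), 1; 1, -1] det_cayleyTwo_ne_zero *
            Matrix.GeneralLinearGroup.mkOfDetNeZero
              (Matrix.diagonal ![((Real.sqrt (|(σ (a 0)).re| / 2) : ℝ) : ℂ), ((Real.sqrt (|(σ (a 1)).re| / 2) : ℝ) : ℂ)])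
              (det_blockScale_ne_zero _ _ hsgn))⁻¹ * (g : GL (Fin 2) ℂ) *
          (Matrix.GeneralLinearGroup.mkOfDetNeZero !![(1 : ℂ), 1; 1, -1] det_cayleyTwo_ne_zero *
            Matrix.GeneralLinearGroup.mkOfDetNeZero
              (Matrix.diagonal ![((Real.sqrt (|(σ (a 0)).re| / 2) : ℝ) : ℂ), ((Real.sqrt (|(σ (a 1)).re| / 2) : ℝ) : ℂ)])
              (det_blockScale_ne_zero _ _ hsgn))) := by
  obtain ⟨φ, hφ, hval⟩ := exists_continuousMulEquiv_diagonal_weights_std σ a hreal hsgn hJ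
  refine ⟨φ, hφ, hval, fun g => ?_⟩
  have h := hval (φ.symm g)
  rw [ContinuousMulEquiv.apply_symm_apply] at h
  -- solve `T⁻¹ g T = x` from `g = T x T⁻¹`
  rw [h]
  group

/-! ## §3 (ED. 2) Composing with the block splitting: `G ≃ₜ* B × K` and `B ≃ₜ* U` give `G ≃ₜ* U × K` (no `ContinuousMulEquiv.prodCongr` in Mathlib) -/

/-- **Product congruence for topological-group isomorphisms, existence form**: from `e : G ≃ₜ* B × K` and `φ : B ≃ₜ* U` one gets `e′ : G ≃ₜ* U × K` with
`e′ g = (φ (e g).1, (e g).2)` (Mathlib has `MulEquiv.prodCongr` but no `≃ₜ*` twin; LH3-p02 (g3)'s term).  Consumers of (B-STD): `eM := e′` for `e` = (M-UNFOLD)'s splitting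
and `φ` = `exists_continuousMulEquiv_diagonal_weights_std`. [cite: PlatonovRapinchuk1994, §2.3] -/
theorem exists_continuousMulEquiv_prodMap {G B U K : Type*} [MulOneClass G] [MulOneClass B] [MulOneClass U] [MulOneClass K]
    [TopologicalSpace G] [TopologicalSpace B] [TopologicalSpace U] [TopologicalSpace K]
    (e : G ≃ₜ* B × K) (φ : B ≃ₜ* U) : ∃ e' : G ≃ₜ* U × K, ∀ g, e' g = (φ (e g).1, (e g).2) := by
  let ψ : G ≃* U × K := e.toMulEquiv.trans (MulEquiv.prodCongr φ.toMulEquiv (MulEquiv.refl K))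
  have h1 : Continuous ψ := by
    have h : Continuous fun g : G => (φ (e g).1, (e g).2) :=
      (φ.continuous.comp (continuous_fst.comp e.continuous)).prodMk (continuous_snd.comp e.continuous)
    exact h
  have h2 : Continuous ψ.symm := by
    have h : Continuous fun y : U × K => e.symm (φ.symm y.1, y.2) :=
      e.symm.continuous.comp ((φ.symm.continuous.comp continuous_fst).prodMk continuous_snd)
    exact h
  exact ⟨{ ψ with continuous_toFun := h1, continuous_invFun := h2 }, fun _ => rfl⟩

/-- **(B-STD) composed with a block splitting**: for real diagonal weights of opposite signs and any `e : G ≃ₜ* U(σ(diag a)) × K`, there is `e′ : G ≃ₜ* U(J) × K` with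
`e′ g = (φ (e g).1, (e g).2)` for a `φ` with the torus and value clauses of `exists_continuousMulEquiv_diagonal_weights_std` — the `eM` every organ-J consumer binds.
[cite: PlatonovRapinchuk1994, §2.3] [cite: Rogawski1990, §8.2 p. 122] -/
theorem exists_continuousMulEquiv_prod_std {G K : Type*} [MulOneClass G] [MulOneClass K] [TopologicalSpace G] [TopologicalSpace K]
    (σ : L →+* ℂ) (a : Fin 2 → L) (hreal : ∀ i, (σ (a i)).im = 0)
    (hsgn : (σ (a 0)).re * (σ (a 1)).re < 0) (hJ : J = (StdForm.antidiagonal 2).over ℂ)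
    (e : G ≃ₜ* ↥(unitaryGroupOfForm (starRingEnd ℂ) ((Matrix.diagonal a).map σ)) × K) :
    ∃ (φ : ↥(unitaryGroupOfForm (starRingEnd ℂ) ((Matrix.diagonal a).map σ)) ≃ₜ* ↥(unitaryGroupOfForm (starRingEnd ℂ) J))
      (e' : G ≃ₜ* ↥(unitaryGroupOfForm (starRingEnd ℂ) J) × K),
      (∀ g, e' g = (φ (e g).1, (e g).2)) ∧
      (∀ u : Fin 2 → Circle,
        φ ⟨circleDiagonal 2 u, circleDiagonal_mem_unitaryGroupOfForm_diagonal_map_weights σ a u⟩ =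
          ⟨Matrix.GeneralLinearGroup.mkOfDetNeZero !![(1 : ℂ), 1; 1, -1] det_cayleyTwo_ne_zero * circleDiagonal 2 u *
              (Matrix.GeneralLinearGroup.mkOfDetNeZero !![(1 : ℂ), 1; 1, -1] det_cayleyTwo_ne_zero)⁻¹,
            cayley_conj_circleDiagonal_mem_of_eq_over hJ u⟩) ∧
      (∀ h : ↥(unitaryGroupOfForm (starRingEnd ℂ) ((Matrix.diagonal a).map σ)),
        ((φ h : ↥(unitaryGroupOfForm (starRingEnd ℂ) J)) : GL (Fin 2) ℂ) =
          Matrix.GeneralLinearGroup.mkOfDetNeZero !![(1 : ℂ), 1; 1, -1] det_cayleyTwo_ne_zero *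
            Matrix.GeneralLinearGroup.mkOfDetNeZero
              (Matrix.diagonal ![((Real.sqrt (|(σ (a 0)).re| / 2) : ℝ) : ℂ), ((Real.sqrt (|(σ (a 1)).re| / 2) : ℝ) : ℂ)])
              (det_blockScale_ne_zero _ _ hsgn) * (h : GL (Fin 2) ℂ) *
          (Matrix.GeneralLinearGroup.mkOfDetNeZero !![(1 : ℂ), 1; 1, -1] det_cayleyTwo_ne_zero *
            Matrix.GeneralLinearGroup.mkOfDetNeZero
              (Matrix.diagonal ![((Real.sqrt (|(σ (a 0)).re| / 2) : ℝ) : ℂ), ((Real.sqrt (|(σ (a 1)).re| / 2) : ℝ) : ℂ)])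
              (det_blockScale_ne_zero _ _ hsgn))⁻¹) := by
  obtain ⟨φ, hφ, hval⟩ := exists_continuousMulEquiv_diagonal_weights_std σ a hreal hsgn hJ
  obtain ⟨e', he'⟩ := exists_continuousMulEquiv_prodMap e φ
  exact ⟨φ, e', he', hφ, hval⟩

end Literature.NumberTheory.Automorphic.UnitaryGroup

end
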